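import Mathlib
import HarnessLib
import Summits.SmoothPoincare4.SmoothPoincare4.Theses.CartanHadamardSwindle
import Literature.Topology.FourManifolds.Isotopy

/-!
# Birth skeleton (BC3) — crux `CartanHadamardSwindle.SmoothSchoenfliesFour` (stmt-SmoothPoincare4-10765)

`Cruxes/SmoothSchoenfliesFour/Lines/birth.lean` · registrar planner-skel-stmt-SmoothPoincare4-10765-0 ·
2026-08-17 · mode skeleton-register (route re-audit bin REPAIRABLE).  The crux is FIXED and is concluded
BY NAME:

  `Summit.SmoothPoincare4.SmoothPoincare4.Theses.CartanHadamardSwindle.SmoothSchoenfliesFour`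

= the smooth 4-dimensional Schoenflies conjecture, equator form (every smooth embedding `f : S³ → S⁴` is
carried onto the equator `{x₄ = 0}` by a diffeomorphism of `S⁴`); `Iff.rfl` with the conjecture leaf
`Literature.Topology.FourManifolds.SmoothSchoenfliesConjectureFour` (Kirby list 4.32), hence with the shared
items stmt-SmoothPoincare4-0372 (`SchoenfliesSplit.SchsplitSchoenflies`) and stmt-SmoothPoincare4-13498
(`SmoothBijectionDefect.SbdSchoenflies`).  In route `CartanHadamardSwindle` it is conjunct (B) of
`X = FJ4 ∧ SCH`, rank 6, "not attacked by this route" (route file): the route's lever (Cartan–Hadamard +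
the covering swindle) yields only UNIT information — punctured homotopy 4-spheres embed in `ℝ⁴` — which every
Schoenflies ball already has, so no route-internal cut of (B) exists and the skeleton is a classical line.

## The cut — UNROLL THE HOPF HOST (Mazur 1959/60s; Gabai, arXiv:2212.02004, Thm. 0.1)

The route's motto is "unroll the host": sum the unknown object into a known host and lift to the universal
cover.  For an embedded 3-sphere `Σ = f(S³) ⊂ S⁴` the host is the Hopf manifold `S¹ × S³` (named as a
host in the route's `CoveringSwindle` docstring) and its universal cover is the cylinder
`ℝ × S³ = S⁴ ∖ {N, S}` (the two poles), the deck group `ℤ` acting by `(t, p) ↦ (t + 1, p)`.  Mazur's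
reformulation of the conjecture (known since the 1960s, written up with proof as Gabai 2022, Thm. 0.1,
p. 1 and p. 3; Budney–Gabai, arXiv:1912.09029, Remark 9.12): **SS4 fails iff some `φ ∈ Diff₀(S¹ × S³)` has
`φ(x₀ × S³)` non-isotopic to `x₀ × S³` even after lifting to every finite-sheeted cover** — equivalently
(lifting isotopies of the simply connected `S³`, and pushing compactly supported isotopies of `ℝ × S³` down
to a high finite cover) iff the lift `Φ` of `φ` to `ℝ × S³` KNOTS the fibre `S₀ = {0} × S³` in `ℝ × S³`.
The proof of Thm. 0.1 (loc. cit. p. 3) is exactly the four stubs below, stated over Mathlib + the tree's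
`Isotopy.lean` (`IsSmoothlyIsotopic`) with four pieces of inline vocabulary (§0): the fibre `fibreZero`,
the band `unitBand = (−½, ½) × S³` (interior of a fundamental domain), `EndSeparating` (a subset of
`ℝ × S³` separates the two ends — the set-level form of "homologous to `S₀` in `H₃(S⁴ ∖ {N, S})`", Gabai's
Lemma 1.1), `IsDeckEquivariant Φ` (`Φ (t + 1, p) = Φ (t, p) + (1, 0)`: `Φ` covers a diffeomorphism of
`S¹ × S³` of degree `+1` on `π₁`), and `IsUnrolling j` (a smooth embedding `j : ℝ × S³ → S⁴` with
`j(S₀) =` the equator — the unrolling chart of `S⁴ ∖ {N, S}`).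

* `stub_band` (KNOWN; L) — BAND POSITION: for every smooth embedding `f : S³ → S⁴` there are an unrolling
  chart `j`, a diffeomorphism `ψ` of `S⁴` and a smooth embedding `g : S³ → ℝ × S³` with `ψ ∘ f = j ∘ g`,
  `range g ⊆ unitBand` and `range g` end-separating.  Content: smooth Jordan–Brouwer separation (tree:
  `JordanBrouwerClosedHypersurface.lean`, `SchoenfliesSeparation.lean`) to pick the poles' preimages `E, W`
  on opposite sides of `range f`; two-point homogeneity of `S⁴` (tree `FiniteHomogeneity.lean` /
  `Homogeneity.lean`) for a `ψ₁` with `ψ₁ E = S`, `ψ₁ W = N`; the explicit cylinder chart `j` of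
  `S⁴ ∖ {N, S}` (latitude `x₄ = tanh t`); a compactly supported diffeotopy of `ℝ × S³` (extended by `id`
  over the poles) squeezing the compact `j⁻¹(ψ₁ (range f))` into the band.  [Mazur1959; arXiv:2212.02004
  p. 3 "after isotopy, we can assume Σ ⊂ (−1/2, 1/2) × S³ and is homologous to S₀ there"; HirschDT1976 Ch. 4, 8]
* `stub_transitive` (KNOWN, deep; XL) — BUDNEY–GABAI TRANSITIVITY, LIFTED: every end-separating smooth
  3-sphere in the band is `Φ(S₀)` for a deck-equivariant diffeomorphism `Φ` of `ℝ × S³` (parametrised: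
  `Φ ∘ ι₀ ∘ θ = g` for some `θ ∈ Diff(S³)`).  Content: project to `S¹ × S³` (injective on the band), where
  the image is a non-separating 3-sphere; Budney–Gabai 2019, Thm. 3.13: `Diff(S¹ × S³)` acts transitively on
  non-separating 3-spheres (4-dimensional light bulb theorem + fibring over `S¹`); correct the `S¹`-degree
  by the reflection `(z, p) ↦ (z̄, p)` (it fixes `x₀ × S³` setwise), lift to `ℝ × S³` and compose with a deck
  translation; two embeddings of `S³` with the same image differ by a diffeomorphism `θ` of `S³`.
  [arXiv:1912.09029 Thm. 3.13; arXiv:2212.02004 p. 3; Gabai2020 (light bulb)]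
* `stub_unknot` (OPEN — THE HEART; Mazur's criterion, the crux TRANSFERRED to the deck-equivariant
  diffeomorphism group of the cylinder) — for every deck-equivariant diffeomorphism `Φ` of `ℝ × S³` (and
  every reparametrisation `θ`), the embedding `Φ ∘ ι₀ ∘ θ : S³ → ℝ × S³` is smoothly isotopic IN `ℝ × S³`
  to an embedding with image the fibre `S₀`.  STATUS: open and EQUIVALENT to the crux modulo the three
  known stubs and their converses (⇒ crux: this file; ⇐ crux: a standard sphere bounds balls on both sides,
  the ball containing the south pole and the lower polar cap are ambient-isotopic by an isotopy fixing both
  poles — Palais' disc theorem through based embeddings `(D⁴, 0) → (S⁴, S)`, `GL⁺(4)` connected, isotopy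
  extension with support off `N` — which restricts to an isotopy of `ℝ × S³`; this is Gabai's Lemma 1.1).
  WHY EASIER / what the transfer exposes: the unknown is no longer an arbitrary embedding but `Φ(S₀)` for
  `Φ` in the GROUP `Diff^ℤ(ℝ × S³)` of lifts of `Diff₀(S¹ × S³)·⟨T⟩`, so (i) pseudo-isotopy theory applies
  to `φ = Φ/ℤ`: `φ` is stably isotopic to `id` (Gabai 2022 Thm. 0.2), with the first Hatcher–Wagoner
  obstruction `Σ` controlling the nested-eye number (Thm. 0.3), and Gabai's Thm. 4.6 / Prop. 7.1 turn the
  stub into an explicit interpolation problem for a regular homotopy whose finger and Whitney discs agree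
  near their boundaries; (ii) S-equivalence classes of `Diff₀(S¹ × S³)` (Gabai Def. 1.6, Prop. 1.7) form a
  group in which the stub reads "every class is trivial", so homomorphisms out of `π₀ Diff₀(S¹ × S³)` —
  now partly computed: Budney–Gabai's barbell classes are non-trivial and give 3-spheres KNOTTED in
  `S¹ × S³` (arXiv:1912.09029 Cor. 8.6) — are tools, and the stub predicts precisely that all of them die
  in the universal cover ("virtually unknotted", loc. cit. Def. 9.13, Thm. 9.11 (iii)); (iii) the statement
  is a lifting/isotopy problem on the FIXED manifold `ℝ × S³` with a `ℤ`-symmetry, open to equivariant and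
  dynamical (translation-length, displacement) arguments that have no analogue for a bare `S³ ⊂ S⁴`.
  Why it might fail: iff SS4 fails (Thm. 0.1) — a deck-equivariant `Φ` knotting `S₀` is an exotic
  Schoenflies sphere; first test family: lifts of the barbell diffeomorphisms `δ_k`.
  [Mazur1959; arXiv:2212.02004 Thm. 0.1, Lemma 1.1, Prop. 1.7, Thms. 0.2, 0.3, 4.6; arXiv:1912.09029 §§8–9]
* `stub_readback` (KNOWN; M) — ISOTOPY READ-BACK: if `g : S³ → ℝ × S³` is smoothly isotopic to an
  embedding onto `S₀` and `j` is an unrolling chart, then `range (j ∘ g)` is carried onto the equator by a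
  diffeomorphism of `S⁴`.  Content: push the isotopy through `j` (composition of smooth embeddings — Mathlib's
  `Manifold.IsSmoothEmbedding.comp` is still `proof_wanted`), isotopy extension on the closed manifold `S⁴`
  (PROVED in the tree for boundaryless sources: `isAmbientIsotopic_of_isSmoothlyIsotopic_of_boundaryless`,
  `IsotopyExtension.lean`; Hirsch 1976 Thm. 8.1.3), and `F₁ '' range (j ∘ g) = range (j ∘ g₁) = j '' S₀`.
  [HirschDT1976 Thm. 8.1.3; Palais1960]

`SmoothSchoenfliesFour_of : Sig.stub_band → Sig.stub_transitive → Sig.stub_unknot → Sig.stub_readback →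
SmoothSchoenfliesFour` is PROVED (§3): band position, transitivity, unknotting in the cover, read-back, and
the final diffeomorphism is `ψ` followed by the read-back diffeomorphism (`Diffeomorph.trans`, set algebra
`(φ ∘ ψ) '' range f = φ '' range (ψ ∘ f) = φ '' range (j ∘ g)`).  Each arrow hands over a different typed
object (chart + band embedding ↦ deck-equivariant `Φ` ↦ isotopy in the cylinder ↦ diffeomorphism of `S⁴`);
no stub is a conjunction seam, none restates the crux or the summit (BC3 probes, below).
`sorry` occurs ONLY in the four `stub_*` theorems; `#print axioms SmoothSchoenfliesFour_of` is standard.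

Relation to the twin skeleton `Cruxes/SbdSchoenflies/Lines/birth.lean` (same statement, stmt-13498): that
line transfers the crux to CLOSED manifolds (unit homotopy 4-spheres are twisted spheres; Cerf); this one
transfers it to the CYLINDER `ℝ × S³` with its deck symmetry (Mazur–Gabai).  The two hearts are different
statements about different objects (`IsUnitSphere S → IsTwistedSphere` vs. `IsDeckEquivariant Φ → Φ(S₀)`
unknots), meeting only at the crux.

## BC3 probes (registrar, 2026-08-17; files `bc/probe_*.lean` of the registrar's folder)

For each of the four stub signatures `T`: `example : T → SmoothSchoenfliesFour` and
`example : T → SmoothPoincare4` by `first | exact? | simpa | aesop` FAIL — results quoted in the registrar's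
NOTES.md and in the crux evidence note (no stub is cheaply the crux or the summit).

## Disproof used

None exists for this crux: `ledger crux ls stmt-SmoothPoincare4-10765` — no workfiles, no `Disproof.lean`,
no `Theorems/SmoothSchoenfliesFour/Negative/*` (2026-08-17); `ledger negatives --problem SmoothPoincare4`:
0 refuted statements.  Honoured item evidence: the refuter's crux-attack (2026-08-15: statement survives,
`Iff.rfl` with the conjecture leaf, equator inclusion is a non-vacuity witness, hypothesis load-bearing) —
the crux is used verbatim and concluded by name; the grounder's identity note (= stmt-0372 = stmt-10753).

## References

* B. Mazur, *On embeddings of spheres*, Bull. AMS 65 (1959) 59–65; Acta Math. 105 (1961). [Mazur1959]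
* D. Gabai, *3-spheres in the 4-sphere and pseudo-isotopies of S¹ × S³*, arXiv:2212.02004 (v2, 2024):
  Thm. 0.1 (p. 1), Lemma 1.1 (p. 2), proof of Thm. 0.1 and of Mazur's theorem (p. 3), Def. 1.3, Def. 1.6,
  Prop. 1.7, Thms. 0.2, 0.3, 0.5. [Gabai2022]
* R. Budney, D. Gabai, *Knotted 3-balls in S⁴*, arXiv:1912.09029: Thm. 3.13, Cor. 8.6, Thm. 9.11,
  Remark 9.12, Def. 9.13. [BudneyGabai2019]
* M. W. Hirsch, *Differential Topology*, GTM 33 (1976), Ch. 8, Thm. 8.1.3 (isotopy extension). [HirschDT1976]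
* R. Palais, *Extending diffeomorphisms*, Proc. AMS 11 (1960). [Palais1960]
* R. Kirby (ed.), *Problems in low-dimensional topology* (1997), Problem 4.32. [KirbyProblems1997]
-/

-- `Summit.<Summit>.<Problem>`: single-conjunct summit, the duplicate component is mandated (CONVENTIONS §2).
set_option linter.dupNamespace false
set_option linter.unusedVariables false

noncomputable section

namespace Summit.SmoothPoincare4.SmoothPoincare4.Cruxes.SmoothSchoenfliesFour.Birth

open scoped Manifold ContDiff Topology
open Set Function
open Literature.Topology.FourManifolds (IsSmoothlyIsotopic sphereFourEquator)
open Summit.SmoothPoincare4.SmoothPoincare4.Theses.CartanHadamardSwindle (SmoothSchoenfliesFour)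

/-- Local notation: the round `3`-sphere `S³ ⊆ ℝ⁴` (Mathlib's analytic manifold, model `𝓡 3`). -/
local notation "𝕊³" => (Metric.sphere (0 : EuclideanSpace ℝ (Fin 4)) 1)
/-- Local notation: the round `4`-sphere `S⁴ ⊆ ℝ⁵` (model `𝓡 4`), the ambient sphere of the crux. -/
local notation "𝕊⁴" => (Metric.sphere (0 : EuclideanSpace ℝ (Fin 5)) 1)
/-- Local notation: the model with corners of the cylinder `ℝ × S³` (the unrolled Hopf host
`S⁴ ∖ {N, S}`, universal cover of `S¹ × S³`): `𝓘(ℝ, ℝ).prod (𝓡 3)` on Mathlib's product manifold. -/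
local notation "𝓒" => (ModelWithCorners.prod 𝓘(ℝ, ℝ) (𝓡 3))

/-! ## §0 Vocabulary — the cylinder `ℝ × S³`, its fibre, its ends, its deck symmetry, its chart -/

/-- **The fibre** `S₀ = {0} × S³ ⊆ ℝ × S³` (the lift of `x₀ × S³ ⊆ S¹ × S³` through the origin; under an
unrolling chart it is the equator of `S⁴`). [arXiv:2212.02004, p. 3 (`S₀ = 0 × S³`)] -/
def fibreZero : Set (ℝ × 𝕊³) :=
  {x | x.1 = 0}

/-- **The band** `(−½, ½) × S³ ⊆ ℝ × S³`: the interior of a fundamental domain of the deck translation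
`(t, p) ↦ (t + 1, p)`, on which the covering projection to `S¹ × S³` is injective.
[arXiv:2212.02004, p. 3 (`Σ ⊂ (−1/2, 1/2) × S³`)] -/
def unitBand : Set (ℝ × 𝕊³) :=
  {x | x.1 ∈ Set.Ioo (-(1 / 2 : ℝ)) (1 / 2)}

/-- **`T` separates the two ends of the cylinder**: no point of height `1` lies in the connected component,
inside the complement of `T`, of a point of height `−1`.  For a subset of the band this says that `T`
separates `(−∞, −½] × S³` from `[½, ∞) × S³`; for an embedded 3-sphere `Σ ⊆ ℝ × S³ = S⁴ ∖ {N, S}` it is the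
set-level form of "`Σ` represents a generator of `H₃(S⁴ ∖ {N, S}) ≅ ℤ`", i.e. "the poles lie on opposite
sides of `Σ`" (Gabai's Lemma 1.1 hypothesis). [arXiv:2212.02004, Lemma 1.1] -/
def EndSeparating (T : Set (ℝ × 𝕊³)) : Prop :=
  ∀ p q : 𝕊³, ((1 : ℝ), q) ∉ connectedComponentIn Tᶜ ((-1 : ℝ), p)

/-- **Deck-equivariance**: the diffeomorphism `Φ` of `ℝ × S³` commutes with the deck translation
`(t, p) ↦ (t + 1, p)`, i.e. `Φ` is a lift of a diffeomorphism of `S¹ × S³ = (ℝ × S³)/ℤ` inducing `+1` on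
`π₁ = ℤ` (every `φ ∈ Diff₀(S¹ × S³)` lifts to such a `Φ`; Gabai's `φ̃`, Notation 1.5).
[arXiv:2212.02004, Notation 1.5] -/
def IsDeckEquivariant (Φ : (ℝ × 𝕊³) ≃ₘ⟮𝓒, 𝓒⟯ (ℝ × 𝕊³)) : Prop :=
  ∀ x : ℝ × 𝕊³, Φ (x.1 + 1, x.2) = ((Φ x).1 + 1, (Φ x).2)

/-- **Unrolling chart**: a smooth embedding `j : ℝ × S³ → S⁴` carrying the fibre `S₀` ONTO the equator
`sphereFourEquator = {x | x₄ = 0}` (intended witness: the cylinder chart of `S⁴ ∖ {N, S}`,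
`(t, p) ↦ (p / cosh t, tanh t)`, whose image misses exactly the two poles; any smooth embedding with
`j(S₀) =` equator will do for the read-back). [Mazur1959; arXiv:2212.02004, p. 3
("view `S⁴` as `[−∞, ∞] × S³` with `±∞ × S³` identified to points")] -/
def IsUnrolling (j : ℝ × 𝕊³ → 𝕊⁴) : Prop :=
  Manifold.IsSmoothEmbedding 𝓒 (𝓡 4) ∞ j ∧ j '' fibreZero = sphereFourEquator

/-! ### Sanity of the vocabulary (definitional / elementary, sorry-free) -/

/-- The crux is verbatim the conjecture leaf (grounder g18-7 / refuter rattack-10765, 2026-08-15; re-checked). -/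
example : SmoothSchoenfliesFour ↔ Literature.Topology.FourManifolds.SmoothSchoenfliesConjectureFour :=
  Iff.rfl

/-- The fibre is end-separating in the elementary sense that heights `−1` and `1` lie on opposite sides of
height `0`: a point of the fibre has height `0`, points of height `±1` do not (so the complement of the fibre
contains both test points — the separation itself is the intermediate value theorem along the first
coordinate, not needed by the skeleton and left to `stub_band`'s provers). [folklore] -/
example (p : 𝕊³) : ((-1 : ℝ), p) ∈ fibreZeroᶜ ∧ ((1 : ℝ), p) ∈ fibreZeroᶜ := by
  simp [fibreZero]

/-- The identity of the cylinder is deck-equivariant (the vocabulary is inhabited; the deck translation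
`(t, p) ↦ (t + 1, p)` and every lift of an element of `Diff₀(S¹ × S³)` are the intended instances).
[folklore] -/
example : IsDeckEquivariant (Diffeomorph.refl 𝓒 (ℝ × 𝕊³) ∞) := by
  intro x
  rfl

/-! ## §1 The stub SIGNATURES (`Sig.stub_<name>`: the skeleton audit reads the hypotheses of
`SmoothSchoenfliesFour_of` BY NAME, heads = stub names; each registered stub below restates its `Sig` in
full so that the registered signature is informative, and `smoothSchoenfliesFour_of_stubs` checks
definitionally that the two copies agree) -/

/-- **STUB 1 — BAND POSITION** (known mathematics; formal size L).  See the module docstring.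
Why it might fail: only as typed (the existential unrolling chart `j` must be a genuine `C^∞` embedding of
the product manifold `ℝ × S³` with `j(S₀)` exactly the equator; `EndSeparating` must be delivered from
Jordan–Brouwer separation of `range f` with the two pole-preimages chosen on opposite sides).
Sources: Mazur1959; arXiv:2212.02004 p. 3; HirschDT1976 Ch. 4 (isotopy of compacta into a region), Ch. 8;
tree `JordanBrouwerClosedHypersurface.lean`, `SchoenfliesSeparation.lean`, `FiniteHomogeneity.lean`. -/
def Sig.stub_band : Prop :=
  ∀ f : 𝕊³ → 𝕊⁴, Manifold.IsSmoothEmbedding (𝓡 3) (𝓡 4) ∞ f →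
    ∃ (j : ℝ × 𝕊³ → 𝕊⁴) (ψ : 𝕊⁴ ≃ₘ⟮𝓡 4, 𝓡 4⟯ 𝕊⁴) (g : 𝕊³ → ℝ × 𝕊³),
      IsUnrolling j ∧ Manifold.IsSmoothEmbedding (𝓡 3) 𝓒 ∞ g ∧ ⇑ψ ∘ f = j ∘ g ∧
        Set.range g ⊆ unitBand ∧ EndSeparating (Set.range g)

/-- **STUB 2 — BUDNEY–GABAI TRANSITIVITY, LIFTED TO THE CYLINDER** (known, deep; formal size XL).
Every end-separating smoothly embedded 3-sphere inside the band is the image of the fibre under a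
deck-equivariant diffeomorphism of `ℝ × S³`; parametrised form: `Φ ∘ ι₀ ∘ θ = g` for a diffeomorphism `θ`
of `S³`.  = Budney–Gabai 2019 Thm. 3.13 (`Diff(S¹ × S³)` acts transitively on non-separating 3-spheres;
light bulb theorem + fibring) projected/lifted as in the proof of Gabai 2022 Thm. 0.1 (p. 3), with the
`S¹`-degree corrected by `(z, p) ↦ (z̄, p)` and a deck translation.
Why it might fail: only as typed (`EndSeparating` is essential — a null-homologous sphere in the band is
never `Φ(S₀)`; the band hypothesis makes the projection injective).
Sources: arXiv:1912.09029 Thm. 3.13; arXiv:2212.02004 p. 3, Notation 1.5; Gabai2020 (light bulb, tree fact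
`Gabai2020_thm_1_9_lightBulb`). -/
def Sig.stub_transitive : Prop :=
  ∀ g : 𝕊³ → ℝ × 𝕊³, Manifold.IsSmoothEmbedding (𝓡 3) 𝓒 ∞ g → Set.range g ⊆ unitBand →
    EndSeparating (Set.range g) →
      ∃ (Φ : (ℝ × 𝕊³) ≃ₘ⟮𝓒, 𝓒⟯ (ℝ × 𝕊³)) (θ : 𝕊³ ≃ₘ⟮𝓡 3, 𝓡 3⟯ 𝕊³),
        IsDeckEquivariant Φ ∧ (⇑Φ ∘ fun p : 𝕊³ => ((0 : ℝ), θ p)) = g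

/-- **STUB 3 — MAZUR'S CRITERION: DECK-EQUIVARIANT DIFFEOMORPHISMS UNKNOT THE FIBRE IN THE CYLINDER**
(OPEN — the heart; the crux transferred to `Diff^ℤ(ℝ × S³)`).  For every deck-equivariant diffeomorphism
`Φ` of `ℝ × S³` and every `θ ∈ Diff(S³)`, the embedding `Φ ∘ ι₀ ∘ θ` is smoothly isotopic, inside
`ℝ × S³`, to an embedding whose image is the fibre `S₀`.  Equivalent to the crux modulo stubs 1, 2, 4 and
Gabai's Lemma 1.1 (module docstring: ⇒ this file; ⇐ Palais' disc theorem through based balls at the south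
pole, isotopy extension supported off the north pole).  = the contrapositive of Gabai 2022 Thm. 0.1 in the
universal cover ("`φ(x₀ × S³)` isotopic to `x₀ × S³` after lifting to some finite cover" ⟺ the lift unknots
in `ℝ × S³`: isotopies of the simply connected `S³` lift, compactly supported isotopies of `ℝ × S³` descend
to a high finite cyclic cover).  WHY EASIER: pseudo-isotopy / stable-isotopy theory of `Diff₀(S¹ × S³)`
(Gabai Thms. 0.2, 0.3, 4.6, Prop. 7.1), the group of S-equivalence classes (Def. 1.6, Prop. 1.7), the
computed barbell part of `π₀ Diff₀(S¹ × S³)` (Budney–Gabai) as a test family, and the `ℤ`-symmetry of a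
fixed cylinder — none of which is visible on a bare `S³ ⊂ S⁴`.
Why it might fail: iff the Schoenflies conjecture fails (Gabai Thm. 0.1; an equivariant `Φ` knotting `S₀`
IS an exotic Schoenflies sphere) — informative either way; first test: lifts of the barbell
diffeomorphisms `δ_k` (arXiv:1912.09029 Cor. 8.6: knotted in `S¹ × S³`; predicted virtually unknotted,
Def. 9.13).  Sources: Mazur1959; arXiv:2212.02004 Thm. 0.1, Lemma 1.1, §1; arXiv:1912.09029 §§8–9;
KirbyProblems1997 4.32.  Size: open problem. -/
def Sig.stub_unknot : Prop :=
  ∀ (Φ : (ℝ × 𝕊³) ≃ₘ⟮𝓒, 𝓒⟯ (ℝ × 𝕊³)) (θ : 𝕊³ ≃ₘ⟮𝓡 3, 𝓡 3⟯ 𝕊³), IsDeckEquivariant Φ →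
    ∃ g₁ : 𝕊³ → ℝ × 𝕊³,
      IsSmoothlyIsotopic (𝓡 3) 𝓒 (⇑Φ ∘ fun p : 𝕊³ => ((0 : ℝ), θ p)) g₁ ∧ Set.range g₁ = fibreZero

/-- **STUB 4 — ISOTOPY READ-BACK THROUGH THE UNROLLING CHART** (known; formal size M).  If
`g : S³ → ℝ × S³` is smoothly isotopic to an embedding `g₁` onto the fibre and `j` is an unrolling chart,
some diffeomorphism of `S⁴` carries `range (j ∘ g)` onto the equator.  Proof: `j ∘ G_t` is a smooth isotopy
of embeddings `S³ → S⁴` (composition of smooth embeddings; Mathlib `IsSmoothEmbedding.comp` is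
`proof_wanted`), isotopy extension on the closed `S⁴` (tree theorem
`isAmbientIsotopic_of_isSmoothlyIsotopic_of_boundaryless`) gives an ambient `F` with
`F₁ ∘ (j ∘ g) = j ∘ g₁`, and `F₁ '' range (j ∘ g) = range (j ∘ g₁) = j '' range g₁ = j '' S₀ =` equator.
Why it might fail: only as typed (it is the read-back lemma).  Sources: HirschDT1976 Thm. 8.1.3;
Palais1960; tree `Isotopy.lean`, `IsotopyExtension.lean`. -/
def Sig.stub_readback : Prop :=
  ∀ j : ℝ × 𝕊³ → 𝕊⁴, IsUnrolling j → ∀ g g₁ : 𝕊³ → ℝ × 𝕊³,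
    IsSmoothlyIsotopic (𝓡 3) 𝓒 g g₁ → Set.range g₁ = fibreZero →
      ∃ φ : 𝕊⁴ ≃ₘ⟮𝓡 4, 𝓡 4⟯ 𝕊⁴, φ '' Set.range (j ∘ g) = sphereFourEquator

/-! ## §2 The registered stubs (the ONLY `sorry`s of this file; statements = the `Sig`s written out) -/

/-- Registered stub 1 (known, L): BAND POSITION.  See `Sig.stub_band`. [Mazur1959; arXiv:2212.02004 p. 3] -/
theorem stub_band :
    ∀ f : 𝕊³ → 𝕊⁴, Manifold.IsSmoothEmbedding (𝓡 3) (𝓡 4) ∞ f →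
      ∃ (j : ℝ × 𝕊³ → 𝕊⁴) (ψ : 𝕊⁴ ≃ₘ⟮𝓡 4, 𝓡 4⟯ 𝕊⁴) (g : 𝕊³ → ℝ × 𝕊³),
        IsUnrolling j ∧ Manifold.IsSmoothEmbedding (𝓡 3) 𝓒 ∞ g ∧ ⇑ψ ∘ f = j ∘ g ∧
          Set.range g ⊆ unitBand ∧ EndSeparating (Set.range g) := by
  sorry

/-- Registered stub 2 (known, deep, XL): BUDNEY–GABAI TRANSITIVITY, LIFTED.  See `Sig.stub_transitive`.
[arXiv:1912.09029 Thm. 3.13; arXiv:2212.02004 p. 3] -/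
theorem stub_transitive :
    ∀ g : 𝕊³ → ℝ × 𝕊³, Manifold.IsSmoothEmbedding (𝓡 3) 𝓒 ∞ g → Set.range g ⊆ unitBand →
      EndSeparating (Set.range g) →
        ∃ (Φ : (ℝ × 𝕊³) ≃ₘ⟮𝓒, 𝓒⟯ (ℝ × 𝕊³)) (θ : 𝕊³ ≃ₘ⟮𝓡 3, 𝓡 3⟯ 𝕊³),
          IsDeckEquivariant Φ ∧ (⇑Φ ∘ fun p : 𝕊³ => ((0 : ℝ), θ p)) = g := by
  sorry

/-- Registered stub 3 (OPEN, hardest, the crux's heart): MAZUR'S CRITERION — deck-equivariant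
diffeomorphisms of the cylinder unknot the fibre.  See `Sig.stub_unknot`.
[Mazur1959; arXiv:2212.02004 Thm. 0.1] -/
theorem stub_unknot :
    ∀ (Φ : (ℝ × 𝕊³) ≃ₘ⟮𝓒, 𝓒⟯ (ℝ × 𝕊³)) (θ : 𝕊³ ≃ₘ⟮𝓡 3, 𝓡 3⟯ 𝕊³), IsDeckEquivariant Φ →
      ∃ g₁ : 𝕊³ → ℝ × 𝕊³,
        IsSmoothlyIsotopic (𝓡 3) 𝓒 (⇑Φ ∘ fun p : 𝕊³ => ((0 : ℝ), θ p)) g₁ ∧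
          Set.range g₁ = fibreZero := by
  sorry

/-- Registered stub 4 (known, M): ISOTOPY READ-BACK.  See `Sig.stub_readback`. [HirschDT1976 Thm. 8.1.3] -/
theorem stub_readback :
    ∀ j : ℝ × 𝕊³ → 𝕊⁴, IsUnrolling j → ∀ g g₁ : 𝕊³ → ℝ × 𝕊³,
      IsSmoothlyIsotopic (𝓡 3) 𝓒 g g₁ → Set.range g₁ = fibreZero →
        ∃ φ : 𝕊⁴ ≃ₘ⟮𝓡 4, 𝓡 4⟯ 𝕊⁴, φ '' Set.range (j ∘ g) = sphereFourEquator := by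
  sorry

/-! ## §3 The composition — the crux BY NAME from the four stubs (real proof, no `sorry`) -/

/-- **Skeleton theorem.**  Band position, lifted transitivity, Mazur unknotting and read-back imply the crux
`Theses.CartanHadamardSwindle.SmoothSchoenfliesFour` BY NAME.  Fix a smooth embedding `f : S³ → S⁴`.
Stub 1 puts it in band position: `ψ ∘ f = j ∘ g` with `g` an end-separating embedding into the band of the
cylinder and `j` an unrolling chart; stub 2 writes `g = Φ ∘ ι₀ ∘ θ` with `Φ` deck-equivariant; stub 3
isotopes that embedding, inside the cylinder, onto the fibre; stub 4 reads the isotopy back in `S⁴` as a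
diffeomorphism `φ` carrying `range (j ∘ g)` onto the equator; then `ψ` followed by `φ` carries `range f`
onto the equator: `(φ ∘ ψ) '' range f = φ '' range (ψ ∘ f) = φ '' range (j ∘ g)`.
[arXiv:2212.02004, proof of Thm. 0.1, p. 3] -/
theorem SmoothSchoenfliesFour_of :
    Sig.stub_band → Sig.stub_transitive → Sig.stub_unknot → Sig.stub_readback →
      SmoothSchoenfliesFour := by
  intro hBand hTrans hUnknot hRead f hf
  -- band position: `ψ ∘ f = j ∘ g`, `g` end-separating in the band, `j` an unrolling chart
  obtain ⟨j, ψ, g, hj, hg, hfg, hband, hsep⟩ := hBand f hf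
  -- Budney–Gabai transitivity, lifted: `g = Φ ∘ ι₀ ∘ θ` with `Φ` deck-equivariant
  obtain ⟨Φ, θ, hΦ, hΦg⟩ := hTrans g hg hband hsep
  -- the heart: in the cylinder, `Φ ∘ ι₀ ∘ θ` is isotopic onto the fibre
  obtain ⟨g₁, hiso, hrange⟩ := hUnknot Φ θ hΦ
  rw [hΦg] at hiso
  -- read the isotopy back in `S⁴`
  obtain ⟨φ, hφ⟩ := hRead j hj g g₁ hiso hrange
  refine ⟨ψ.trans φ, ?_⟩
  rw [Diffeomorph.coe_trans, Set.image_comp, ← Set.range_comp, hfg]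
  exact hφ

/-- The crux by name, closed modulo the four registered stubs (its axiom closure contains `sorryAx`
through the stubs only; `SmoothSchoenfliesFour_of` itself is sorry-free).  The application type-checks
only because each registered `stub_*` is definitionally its `Sig`. -/
theorem smoothSchoenfliesFour_of_stubs : SmoothSchoenfliesFour :=
  SmoothSchoenfliesFour_of stub_band stub_transitive stub_unknot stub_readback

end Summit.SmoothPoincare4.SmoothPoincare4.Cruxes.SmoothSchoenfliesFour.Birth

end
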